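import Literature.NumberTheory.GaloisRepresentations.LubinTateColemanRelativeTwo
import HarnessLib

/-!
# `q = 2`: the reflection `G ↦ G(−π − X)` of `𝒪_E⟦X⟧` and Coleman's operators `𝒩_E`, `𝒮_E` with coefficients in
# `𝒪_E`, for every finite `E ⊇ F` — `(𝒩_E G) ∘ f = G·G(−π − X)`, `(𝒮_E G) ∘ f = G + G(−π − X)`

De Shalit, *Iwasawa theory of elliptic curves with complex multiplication* (1987), Ch. I §2.1 (1), §3.12 (23), over
an extended coefficient ring (I §3.8: "viewing `F_f` over an unramified extension `k''` of `k'`").  With the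
`F`-rational Coleman family `{0, −π} ⊂ 𝒪_E` of `LubinTateColemanRelativeTwo.lean` (`f = πX + X²`, `|𝓀_F| = 2`,
`E ⊇ F` any finite extension):

* `reflE hπ E = τ_E : G ↦ G(X [+] (−π))`, an `𝒪_E`-algebra endomorphism of `𝒪_E⟦X⟧` with ★ `coe_tPt_divPtTwo` /
  `reflE_X` — **`τ_E X = −π − X`**, `reflE_C`, `reflE_map_ltSer` (`τ_E f = f`), ★ `reflE_subst` (**`τ_E` fixes
  `𝒪_E⟦f⟧`**), ★ `reflE_reflE` (involution), `reflE_sub_self_mem` (`τ_E G ≡ G mod 𝔪_E`);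
* `relNormTwo hπ E hq = 𝒩_E`, `relTraceTwo hπ E hq = 𝒮_E` — Coleman's operators ON `𝒪_E⟦X⟧` as the `f`-adic
  expansions (`LubinTate.invSer`, no Galois descent) of `G·τ_E G`, `G + τ_E G`: ★ `subst_relNormTwo`,
  ★ `subst_relTraceTwo`, `relNormTwo_mul`, `relNormTwo_one`, `relNormTwoHom` (𝒩_E as a monoid hom), `relTraceTwo_add`, ★ `relTraceTwo_mul_subst` (`𝒮_E(K·(R ∘ f)) = 𝒮_E K · R`),
  ★ `relTraceTwo_subst_add_X_mul_subst` (**`𝒮_E(R₀ ∘ f + X·(R₁ ∘ f)) = 2R₀ − πR₁`**); `subst_map_ltSer_injective`.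

0 sorry, no named facts.  Sequel: `LubinTateColemanRelativeKernelTwo` (Coleman's lemma, the rank-two decomposition
and `ker 𝒮_E = (1 + tX)·𝒪_E⟦f⟧` over `𝒪_E`).

## References

* E. de Shalit, *Iwasawa theory of elliptic curves with complex multiplication* (1987), Ch. I §2.1, §3.8, §3.12.
  [deShalit1987]
-/

noncomputable section

open scoped PowerSeries.WithPiTopology

namespace Literature.NumberTheory.GaloisRepresentations
section LocalFieldRel2b

open GaloisRepresentations.IsNonarchimedeanLocalField LubinTate ValuativeRel

variable (F : Type*) [Field F] [ValuativeRel F] [TopologicalSpace F] [IsNonarchimedeanLocalField F]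

attribute [local instance] ltNormUniformSpace ltNormIsUniformAddGroup rk1 nF nE fintypeResidueField

variable {F}
variable {π : 𝒪[F]} (hπ : (valuation F).IsUniformizer (π : F))
variable (E : IntermediateField F (AlgebraicClosure F)) [FiniteDimensional F E]

/-- `f` is substitutable (`f(0) = 0`). [folklore] -/
private theorem hasSubst_mapLtSer :
    PowerSeries.HasSubst ((ltSer F π).map (algebraMap (LTCoeff F) (unitBall E))) :=
  PowerSeries.HasSubst.of_constantCoeff_zero' ((isLTSeries_ltSer π).map _).constantCoeff_eq_zero

/-! ### The reflection `G ↦ G(−π − X)` of `𝒪_E⟦X⟧` -/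

/-- **The reflection `τ_E : G ↦ G(X [+] ω₁) = G(−π − X)`** of `𝒪_E⟦X⟧` (translation by the non-zero division point).
[cite: deShalit1987, Ch. I §3.12] -/
def reflE : PowerSeries (unitBall E) →ₐ[unitBall E] PowerSeries (unitBall E) :=
  evT (maxNilIdeal F E) (tPt (maxNilIdeal F E) (isLTRing_LTCoeff hπ) (isLTSeries_LTCoeff π) (divPtTwo hπ E 1))

/-- Unfolding. [cite: deShalit1987, Ch. I §3.12] -/
theorem reflE_apply (G : PowerSeries (unitBall E)) :
    reflE hπ E G = evT (maxNilIdeal F E) (tPt (maxNilIdeal F E) (isLTRing_LTCoeff hπ) (isLTSeries_LTCoeff π)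
      (divPtTwo hπ E 1)) G := rfl

/-- ★ **`X [+]_f (−π) = −π − X` in `𝒪_E⟦X⟧`** at `q = 2` (both sides are roots `Z` of `Z² + πZ = f(X)` with constant
term `−π ≠ 0`). [cite: deShalit1987, Ch. I §3.12] -/
theorem coe_tPt_divPtTwo (hq : residueFieldCard F = 2) {c : 𝓀[F]} (hc : c ≠ 0) :
    ((tPt (maxNilIdeal F E) (isLTRing_LTCoeff hπ) (isLTSeries_LTCoeff π) (divPtTwo hπ E c) :
        (seriesNilIdeal (maxNilIdeal F E)).toIdeal) : PowerSeries (unitBall E)) =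
      -PowerSeries.X - PowerSeries.C (algebraMap 𝒪[F] (unitBall E) π) := by
  set S := unitBall E
  set M := maxNilIdeal F E
  set t := tPt M (isLTRing_LTCoeff hπ) (isLTSeries_LTCoeff π) (divPtTwo hπ E c) with ht
  set p : S := algebraMap 𝒪[F] S π with hp
  have hft : evT M t ((ltSer F π).map (algebraMap (LTCoeff F) S)) = (ltSer F π).map (algebraMap (LTCoeff F) S) :=
    evT_tPt_map M (isLTRing_LTCoeff hπ) (isLTSeries_LTCoeff π) _ (ltSMul_divPtTwo hπ E hq c)
  rw [map_ltSer_eq E, hq, map_add, map_mul, map_pow, evT_C, evT_X] at hft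
  have hprod : ((t : PowerSeries S) - PowerSeries.X) * ((t : PowerSeries S) + PowerSeries.X + PowerSeries.C p) = 0 := by
    rw [← hp] at hft
    linear_combination hft
  rcases mul_eq_zero.mp hprod with h | h
  · exfalso
    have h0 := congrArg PowerSeries.constantCoeff h
    rw [map_sub, map_zero, PowerSeries.constantCoeff_X, sub_zero, ht, constantCoeff_tPt,
      coe_divPtTwo_of_ne_zero hπ E hc, neg_eq_zero] at h0
    exact algebraMap_pi_ne_zero hπ E h0
  · linear_combination h

/-- ★ `τ_E X = −X − C π`. [cite: deShalit1987, Ch. I §3.12] -/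
theorem reflE_X (hq : residueFieldCard F = 2) :
    reflE hπ E PowerSeries.X = -PowerSeries.X - PowerSeries.C (algebraMap 𝒪[F] (unitBall E) π) := by
  rw [reflE_apply, evT_X, coe_tPt_divPtTwo hπ E hq one_ne_zero]

/-- `τ_E (C s) = C s`. [cite: deShalit1987, Ch. I §3.12] -/
theorem reflE_C (s : unitBall E) : reflE hπ E (PowerSeries.C s) = PowerSeries.C s := by
  rw [reflE_apply, evT_C]

/-- `τ_E` fixes `f`. [cite: deShalit1987, Ch. I §3.12] -/
theorem reflE_map_ltSer (hq : residueFieldCard F = 2) :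
    reflE hπ E ((ltSer F π).map (algebraMap (LTCoeff F) (unitBall E))) =
      (ltSer F π).map (algebraMap (LTCoeff F) (unitBall E)) :=
  evT_tPt_map _ (isLTRing_LTCoeff hπ) (isLTSeries_LTCoeff π) _ (ltSMul_divPtTwo hπ E hq 1)

/-- ★ **`τ_E` fixes `𝒪_E⟦f⟧`**: `(R ∘ f)(−π − X) = R ∘ f`. [cite: deShalit1987, Ch. I §3.12] -/
theorem reflE_subst (hq : residueFieldCard F = 2) (R : PowerSeries (unitBall E)) :
    reflE hπ E (PowerSeries.subst ((ltSer F π).map (algebraMap (LTCoeff F) (unitBall E))) R) =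
      PowerSeries.subst ((ltSer F π).map (algebraMap (LTCoeff F) (unitBall E))) R :=
  evT_subst_of_evT_eq _ _ ((isLTSeries_ltSer π).map _).constantCoeff_eq_zero (reflE_map_ltSer hπ E hq) R

/-- ★ **`τ_E` is an involution** (`ω₁ [+] ω₁ = 0`). [cite: deShalit1987, Ch. I §3.12] -/
theorem reflE_reflE (hq : residueFieldCard F = 2) (G : PowerSeries (unitBall E)) : reflE hπ E (reflE hπ E G) = G := by
  rw [reflE_apply, reflE_apply, evT_evT, evTPt_tPt_tPt, ltAdd_divPtTwo_one_one hπ E hq]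
  have h0 : tPt (maxNilIdeal F E) (isLTRing_LTCoeff hπ) (isLTSeries_LTCoeff π) 0 = serX (maxNilIdeal F E) := by
    rw [tPt, serC_zero, ltAdd_zero]
  rw [h0, evT_serX_apply]

/-- ★ **`τ_E G ≡ G (mod 𝔪_E)`** (coefficientwise): `X [+] ω₁ ≡ X`. [cite: deShalit1987, Ch. I §3.12] -/
theorem reflE_sub_self_mem (G : PowerSeries (unitBall E)) :
    reflE hπ E G - G ∈ coeffIdeal (maxNilIdeal F E).toIdeal := by
  set M := maxNilIdeal F E
  refine evT_sub_self_mem_coeffIdeal M M.toIdeal M.isClosed _ ?_ G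
  -- `X [+] C ω₁ ≡ X [+] 0 = X`
  have e : (PowerSeries.X : PowerSeries (unitBall E)) =
      ((ltAdd (seriesNilIdeal M) (isLTRing_LTCoeff hπ) (isLTSeries_LTCoeff π) (serX M) 0 :
        (seriesNilIdeal M).toIdeal) : PowerSeries (unitBall E)) := by
    rw [ltAdd_zero]; rfl
  rw [e, tPt, ltAdd, ltAdd, addPt, addPt, coe_evalPt, coe_evalPt]
  refine aeval_sub_aeval_mem (coeffIdeal M.toIdeal) (isClosed_coeffIdeal M.isClosed) _ _ (fun i => ?_) _
  fin_cases i
  · simp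
  · change PowerSeries.C ((divPtTwo hπ E 1 : M.toIdeal) : unitBall E) -
      ((0 : (seriesNilIdeal M).toIdeal) : PowerSeries (unitBall E)) ∈ coeffIdeal M.toIdeal
    rw [ZeroMemClass.coe_zero, sub_zero]
    exact C_mem_coeffIdeal (divPtTwo hπ E 1).2

/-! ### Coleman's operators `𝒩_E`, `𝒮_E` on `𝒪_E⟦X⟧` (no descent) -/

/-- `G · τ_E G` is translation invariant under the family. [cite: deShalit1987, Ch. I §2.1] -/
theorem evT_mul_reflE (hq : residueFieldCard F = 2) (G : PowerSeries (unitBall E)) (c : 𝓀[F]) :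
    evT (maxNilIdeal F E) (tPt (maxNilIdeal F E) (isLTRing_LTCoeff hπ) (isLTSeries_LTCoeff π) (divPtTwo hπ E c))
      (G * reflE hπ E G) = G * reflE hπ E G := by
  rcases eq_zero_or_eq_one_two hq c with rfl | rfl
  · rw [divPtTwo_zero, tPt, serC_zero, ltAdd_zero, evT_serX_apply]
  · rw [← reflE_apply, map_mul, reflE_reflE hπ E hq, mul_comm]

/-- `G + τ_E G` is translation invariant under the family. [cite: deShalit1987, Ch. I §3.12] -/
theorem evT_add_reflE (hq : residueFieldCard F = 2) (G : PowerSeries (unitBall E)) (c : 𝓀[F]) :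
    evT (maxNilIdeal F E) (tPt (maxNilIdeal F E) (isLTRing_LTCoeff hπ) (isLTSeries_LTCoeff π) (divPtTwo hπ E c))
      (G + reflE hπ E G) = G + reflE hπ E G := by
  rcases eq_zero_or_eq_one_two hq c with rfl | rfl
  · rw [divPtTwo_zero, tPt, serC_zero, ltAdd_zero, evT_serX_apply]
  · rw [← reflE_apply, map_add, reflE_reflE hπ E hq, add_comm]

/-- **Coleman's norm operator `𝒩_E` on `𝒪_E⟦X⟧`** (`q = 2`): the `f`-adic expansion of `G · G(−π − X)`.
[cite: deShalit1987, Ch. I §2.1 (1)] -/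
def relNormTwo (hq : residueFieldCard F = 2) (G : PowerSeries (unitBall E)) : PowerSeries (unitBall E) :=
  invSer (isColemanFamily_divPtTwo hπ E hq) (G * reflE hπ E G) (evT_mul_reflE hπ E hq G)

/-- **Coleman's trace operator `𝒮_E` on `𝒪_E⟦X⟧`** (`q = 2`): the `f`-adic expansion of `G + G(−π − X)`.
[cite: deShalit1987, Ch. I §3.12 (23)] -/
def relTraceTwo (hq : residueFieldCard F = 2) (G : PowerSeries (unitBall E)) : PowerSeries (unitBall E) :=
  invSer (isColemanFamily_divPtTwo hπ E hq) (G + reflE hπ E G) (evT_add_reflE hπ E hq G)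

/-- ★ **`(𝒩_E G) ∘ f = G · G(−π − X)`.** [cite: deShalit1987, Ch. I §2.1 (1)] -/
theorem subst_relNormTwo (hq : residueFieldCard F = 2) (G : PowerSeries (unitBall E)) :
    PowerSeries.subst ((ltSer F π).map (algebraMap (LTCoeff F) (unitBall E))) (relNormTwo hπ E hq G) =
      G * reflE hπ E G :=
  subst_invSer _ _ _

/-- ★ **`(𝒮_E G) ∘ f = G + G(−π − X)`.** [cite: deShalit1987, Ch. I §3.12 (23)] -/
theorem subst_relTraceTwo (hq : residueFieldCard F = 2) (G : PowerSeries (unitBall E)) :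
    PowerSeries.subst ((ltSer F π).map (algebraMap (LTCoeff F) (unitBall E))) (relTraceTwo hπ E hq G) =
      G + reflE hπ E G :=
  subst_invSer _ _ _

include hπ in
/-- `∘ f` is injective on `𝒪_E⟦X⟧` (uniqueness in `(𝒩h) ∘ f = …`). [cite: deShalit1987, Ch. I §2.1] -/
theorem subst_map_ltSer_injective :
    Function.Injective fun G : PowerSeries (unitBall E) =>
      PowerSeries.subst ((ltSer F π).map (algebraMap (LTCoeff F) (unitBall E))) G :=
  subst_injective_of_isDomain (fun h0 => algebraMap_pi_ne_zero hπ E h0) ((isLTSeries_ltSer π).map _)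

/-- `𝒩_E` is multiplicative. [cite: deShalit1987, Ch. I §2.1] -/
theorem relNormTwo_mul (hq : residueFieldCard F = 2) (G H : PowerSeries (unitBall E)) :
    relNormTwo hπ E hq (G * H) = relNormTwo hπ E hq G * relNormTwo hπ E hq H := by
  refine subst_map_ltSer_injective hπ E ?_
  change PowerSeries.subst _ _ = PowerSeries.subst _ _
  rw [← PowerSeries.coe_substAlgHom (hasSubst_mapLtSer E), map_mul, PowerSeries.coe_substAlgHom,
    subst_relNormTwo, subst_relNormTwo, subst_relNormTwo, map_mul]
  ring

/-- `𝒩_E 1 = 1`. [cite: deShalit1987, Ch. I §2.1] -/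
theorem relNormTwo_one (hq : residueFieldCard F = 2) : relNormTwo hπ E hq 1 = 1 := by
  refine subst_map_ltSer_injective hπ E ?_
  change PowerSeries.subst _ _ = PowerSeries.subst _ _
  rw [subst_relNormTwo, map_one, mul_one, ← PowerSeries.coe_substAlgHom (hasSubst_mapLtSer E), map_one]

/-- **`𝒩_E` as a monoid homomorphism** of `𝒪_E⟦X⟧`. [cite: deShalit1987, Ch. I §2.1] -/
def relNormTwoHom (hq : residueFieldCard F = 2) : PowerSeries (unitBall E) →* PowerSeries (unitBall E) where
  toFun := relNormTwo hπ E hq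
  map_one' := relNormTwo_one hπ E hq
  map_mul' := relNormTwo_mul hπ E hq

/-- Unfolding. [cite: deShalit1987, Ch. I §2.1] -/
theorem relNormTwoHom_apply (hq : residueFieldCard F = 2) (G : PowerSeries (unitBall E)) :
    relNormTwoHom hπ E hq G = relNormTwo hπ E hq G := rfl

/-- `𝒮_E` is additive. [cite: deShalit1987, Ch. I §3.12] -/
theorem relTraceTwo_add (hq : residueFieldCard F = 2) (G H : PowerSeries (unitBall E)) :
    relTraceTwo hπ E hq (G + H) = relTraceTwo hπ E hq G + relTraceTwo hπ E hq H := by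
  refine subst_map_ltSer_injective hπ E ?_
  change PowerSeries.subst _ _ = PowerSeries.subst _ _
  rw [← PowerSeries.coe_substAlgHom (hasSubst_mapLtSer E), map_add, PowerSeries.coe_substAlgHom,
    subst_relTraceTwo, subst_relTraceTwo, subst_relTraceTwo, map_add]
  ring

/-- ★ **`𝒮_E(K · (R ∘ f)) = (𝒮_E K) · R`** (`𝒪_E⟦f⟧`-linearity). [cite: deShalit1987, Ch. I §3.12] -/
theorem relTraceTwo_mul_subst (hq : residueFieldCard F = 2) (K R : PowerSeries (unitBall E)) :
    relTraceTwo hπ E hq (K * PowerSeries.subst ((ltSer F π).map (algebraMap (LTCoeff F) (unitBall E))) R) =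
      relTraceTwo hπ E hq K * R := by
  refine subst_map_ltSer_injective hπ E ?_
  change PowerSeries.subst _ _ = PowerSeries.subst _ _
  rw [← PowerSeries.coe_substAlgHom (hasSubst_mapLtSer E), map_mul, PowerSeries.coe_substAlgHom,
    subst_relTraceTwo, subst_relTraceTwo, map_mul, reflE_subst hπ E hq]
  ring

/-- `𝒮_E 1 = 2`, `𝒮_E X = −π`: ★ **`𝒮_E(R₀ ∘ f + X·(R₁ ∘ f)) = 2R₀ − πR₁`.** [cite: deShalit1987, Ch. I §3.12] -/
theorem relTraceTwo_subst_add_X_mul_subst (hq : residueFieldCard F = 2) (R₀ R₁ : PowerSeries (unitBall E)) :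
    relTraceTwo hπ E hq (PowerSeries.subst ((ltSer F π).map (algebraMap (LTCoeff F) (unitBall E))) R₀ +
        PowerSeries.X * PowerSeries.subst ((ltSer F π).map (algebraMap (LTCoeff F) (unitBall E))) R₁) =
      PowerSeries.C 2 * R₀ - PowerSeries.C (algebraMap 𝒪[F] (unitBall E) π) * R₁ := by
  refine subst_map_ltSer_injective hπ E ?_
  change PowerSeries.subst _ _ = PowerSeries.subst _ _
  rw [subst_relTraceTwo, map_add, map_mul, reflE_subst hπ E hq, reflE_subst hπ E hq, reflE_X hπ E hq,
    ← PowerSeries.coe_substAlgHom (hasSubst_mapLtSer E), map_sub, map_mul, map_mul, PowerSeries.coe_substAlgHom,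
    PowerSeries.C_eq_algebraMap, PowerSeries.C_eq_algebraMap, ← PowerSeries.coe_substAlgHom (hasSubst_mapLtSer E),
    AlgHom.commutes, AlgHom.commutes, PowerSeries.coe_substAlgHom, map_ofNat]
  ring

end LocalFieldRel2b

end Literature.NumberTheory.GaloisRepresentations
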